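import Summits.ABC.IUTFork.LanaRssBridge
import Summits.ABC.IUTFork.ForkEta
import HarnessLib

/-!
# L-LANA objects V ter: the measure-level `η`-datum instantiates the skeleton's `EtaSetting` (XV)

Record-only file (D-0012) of the abc-iut cell (seat abc-iut-c312-4, L-LANA level, N15 ↔ skel XV bridge);
TAKES NO SIDE on [IUTchIII] Cor. 3.12. `ForkEta.lean` (XV) typed LANA's main goal (9-1) over the abstract
datum `EtaSetting` (regions, a real volume, suitable `S`, `LGP`, the `q`-region, the hull, and the POSITED
`vol_LGP_le_hull`); `LanaRss.lean` built regions and volumes from a Mathlib measure space. The bridge: an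
`EtaData` whose suitable output regions lie in the hull (`SuitableInHull`, §8.1 (f)) DETERMINES an
`EtaSetting` with `vol_LGP_le_hull` PROVED (measure monotonicity), and the two typings of (9-1) —
XV's `EtaSetting.MainGoal` (classes in `AbsRss vol`) and `EtaData.MainGoal` (classes in `ℝ^ss = regions /
equal volume`, §9.2 p. 46 verbatim) — AGREE (`EtaData.mainGoal_iff_skel`). Hence XV's `cor312_of_mainGoal`,
VIII's `cor312_of_represented` and the direct `EtaData.cor312_of_mainGoal` are one statement at three levels.
[cite: LANA2026Report, §9.2 p. 46, §9.3 p. 46, §8.1 (f) p. 41] NOT here: any judgement.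
-/

noncomputable section

open MeasureTheory

namespace Summit.ABC
namespace IUTFork
namespace EtaData

variable {Ω : Type} [MeasurableSpace Ω] {μ : Measure Ω} (E : EtaData μ)

/-- **The bridge N15 → XV**: the skeleton's `EtaSetting` carried by a measure-level `η`-datum — regions =
measurable sets of finite nonzero measure, `vol = log-vol`, `S` = the suitable ones, hull = `log-vol(U^{hol})`,
and XV's posited `vol_LGP_le_hull` PROVED. [cite: LANA2026Report, §9.2 p. 46, §8.1 (f),(h) p. 41] -/
def toEtaSetting (h : E.SuitableInHull) : EtaSetting where
  Rval := E.Rval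
  Region := Region μ
  vol := Region.logVol
  S := E.Suitable
  LGP s := E.LGP s.1
  qRegion := E.qRegion
  hull := E.negAbsLogTheta
  vol_LGP_le_hull s := (E.LGP s.1).logVol_mono E.hull (h s.1 s.2)

/-- **The two typings of (9-1) agree**: XV's `EtaSetting.MainGoal` for the carried setting ⟺ the
measure-level `EtaData.MainGoal`. [cite: LANA2026Report, §9.2 (9-1) p. 46] -/
theorem mainGoal_iff_skel (h : E.SuitableInHull) : (E.toEtaSetting h).MainGoal ↔ E.MainGoal := by
  rw [EtaSetting.mainGoal_iff_vol, E.mainGoal_iff_logVol]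
  constructor
  · rintro ⟨⟨S, hS⟩, hvol⟩
    exact ⟨S, hS, hvol⟩
  · rintro ⟨S, hS, hvol⟩
    exact ⟨⟨S, hS⟩, hvol⟩

/-- The skeleton's two routes from the carried setting agree with the measure-level bridge: XV's
`toOutputRegions` of the carried `EtaSetting` IS `LanaRssBridge`'s `toOutputRegions`.
[cite: LANA2026Report, §9.3 p. 46] -/
theorem toEtaSetting_toOutputRegions (h : E.SuitableInHull) :
    (E.toEtaSetting h).toOutputRegions = E.toOutputRegions h := rfl

/-- (9-1) at measure level ⟹ Cor. 3.12's inequality through XV (`EtaSetting.cor312_of_mainGoal`).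
[cite: LANA2026Report, §9 p. 44] -/
theorem cor312_via_skel (h : E.SuitableInHull) (hg : E.MainGoal) : (E.toEtaSetting h).toOutputRegions.Cor312 :=
  (E.toEtaSetting h).cor312_of_mainGoal ((E.mainGoal_iff_skel h).mpr hg)

end EtaData
end IUTFork
end Summit.ABC

end
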